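import Summits.AtomisticToContinuum.Crystallization.Theses.PalmUnimodularRigidity
import Literature.Probability.Process.PointStationaryLaw

/-!
# `stub_return` of line `Sketch` for crux `TwelveWithinOne` (route `SquareWellLayerCake`, K2)

FROM MEASURE-LEVEL K2 WITH SLACK TO THE CRUX. If every minimising point-stationary hard-core law on
rooted configurations of `ℝ³` satisfies K2 with inward slack `σ > 0` at the root almost surely, and
Lennard-Jones ground states have Benjamini–Schramm limits (in density-transfer form) along every
prescribed subsequence, then for every sequence of ground states the fraction of particles failing
[every particle within `11/10` is `55/57`-separated from all others ∧ at least twelve other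
particles within distance `1`] tends to `0`.

Proof. Were the bad fraction `≥ η > 0` along a subsequence `ψ`
(`Filter.extraction_of_frequently_atTop`), take the BS limit `P` along `ψ ∘ φ`; it is minimising
(`E(N)/N → e*`, `CrysEnergyLimit_holds`, `tendsto_nhds_unique`), so the set `T` of good rooted
hard-core configurations has `P T = 1`; density transfer with `R = 3`,
`ε = min σ (min δ δₓ) / 3` (`δₓ` the uniform minimal distance of ground states,
`LennardJonesMinimalDistance_holds`) makes eventually `≥ (1 - η/2)·N` particles `(R, ε)`-matched to
a configuration of `T`, and every matched particle is good (`good_of_matched`): contradiction.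
-/

noncomputable section

open MeasureTheory Filter Set
open scoped ENNReal Topology

namespace Summit.AtomisticToContinuum.Crystallization.Theorems.SquareWellLayerCakeTwelveWithinOne

open Literature.MathematicalPhysics.StatisticalMechanics

/-- **The matching claim (deterministic geometry).** Let `y` be a `δₓ`-separated configuration, `i`
an index, and `S ∋ 0` a `δ`-separated set satisfying K2 with inward slack `σ` at the root (every
point of norm `≤ 11/10 + σ` is `(55/57 + σ)`-separated from all other points; twelve points `≠ 0`
of norm `≤ 1 - σ`). If the recentred configuration `k ↦ y k - y i` and `S` are `ε`-matched within
radius `3` (every point of `S` of norm `≤ 3` has a recentred particle within `ε`, and conversely)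
with `2ε ≤ σ`, `2ε < δ`, `2ε < δₓ`, then `i` is K2-good: every particle within `11/10` of `y i` is
`55/57`-separated from all others, and at least twelve particles `j ≠ i` satisfy
`dist (y i) (y j) ≤ 1`. [folklore] -/
theorem good_of_matched {N : ℕ} (y : Fin N → EuclideanSpace ℝ (Fin 3)) (i : Fin N)
    {σ δ δₓ ε : ℝ} (hε : 0 < ε) (hεσ : 2 * ε ≤ σ) (hεδ : 2 * ε < δ) (hεδₓ : 2 * ε < δₓ)
    (hsepy : ∀ j k : Fin N, j ≠ k → δₓ ≤ dist (y j) (y k))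
    (S : Set (EuclideanSpace ℝ (Fin 3))) (h0 : (0 : EuclideanSpace ℝ (Fin 3)) ∈ S)
    (hS : ∀ p ∈ S, ∀ q ∈ S, p ≠ q → δ ≤ dist p q)
    (hgood₁ : ∀ w ∈ S, ‖w‖ ≤ 11 / 10 + σ → ∀ w' ∈ S, w' ≠ w → 55 / 57 + σ ≤ dist w w')
    (hgood₂ : ∃ T : Finset (EuclideanSpace ℝ (Fin 3)), T.card = 12 ∧
      ∀ w ∈ T, w ∈ S ∧ w ≠ 0 ∧ ‖w‖ ≤ 1 - σ)
    (ha : ∀ p ∈ S, ‖p‖ ≤ 3 → ∃ k : Fin N, dist (y k - y i) p ≤ ε)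
    (hb : ∀ k : Fin N, ‖y k - y i‖ ≤ 3 → ∃ p ∈ S, dist (y k - y i) p ≤ ε) :
    (∀ j : Fin N, dist (y i) (y j) ≤ 11 / 10 →
        ∀ k : Fin N, k ≠ j → (55 : ℝ) / 57 ≤ dist (y j) (y k)) ∧
      12 ≤ (Finset.univ.filter fun j : Fin N => j ≠ i ∧ dist (y i) (y j) ≤ 1).card := by
  refine ⟨?_, ?_⟩
  · -- separation near the root
    intro j hj k hkj
    by_contra hlt
    rw [not_le] at hlt
    have hqj : ‖y j - y i‖ ≤ 11 / 10 := by rwa [← dist_eq_norm, dist_comm]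
    have hqk : ‖y k - y i‖ ≤ 3 := by
      rw [← dist_eq_norm]
      linarith [dist_triangle (y k) (y j) (y i), dist_comm (y k) (y j), dist_comm (y j) (y i)]
    obtain ⟨pj, hpjS, hpj⟩ := hb j (by linarith)
    obtain ⟨pk, hpkS, hpk⟩ := hb k hqk
    have hpj_norm : ‖pj‖ ≤ 11 / 10 + σ := by
      have h := dist_triangle pj (y j - y i) 0
      rw [dist_zero_right, dist_zero_right, dist_comm pj] at h
      linarith
    by_cases hpeq : pk = pj
    · -- both particles matched to the same atom: they are `2ε < δₓ` apart
      rw [hpeq] at hpk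
      have h := dist_triangle (y j - y i) pj (y k - y i)
      rw [dist_sub_right, dist_comm pj (y k - y i)] at h
      have := hsepy j k (fun h' => hkj h'.symm)
      linarith
    · -- distinct atoms: `(55/57 + σ)`-separated, so the particles are `≥ 55/57 + σ - 2ε` apart
      have hsep := hgood₁ pj hpjS hpj_norm pk hpkS hpeq
      have h := dist_triangle4 pj (y j - y i) (y k - y i) pk
      rw [dist_sub_right, dist_comm pj (y j - y i)] at h
      linarith
  · -- twelve neighbours within `1`
    obtain ⟨T, hT12, hT⟩ := hgood₂
    have hchoice : ∀ w : EuclideanSpace ℝ (Fin 3), ∃ k : Fin N,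
        w ∈ T → dist (y k - y i) w ≤ ε := by
      intro w
      by_cases hw : w ∈ T
      · obtain ⟨hwS, -, hw1⟩ := hT w hw
        obtain ⟨k, hk⟩ := ha w hwS (by linarith)
        exact ⟨k, fun _ => hk⟩
      · exact ⟨i, fun h => absurd h hw⟩
    choose kf hkf using hchoice
    rw [← hT12]
    refine Finset.card_le_card_of_injOn kf ?_ ?_
    · intro w hw
      have hwT : w ∈ T := Finset.mem_coe.1 hw
      obtain ⟨hwS, hw0, hw1⟩ := hT w hwT
      have hk := hkf w hwT
      refine Finset.mem_coe.2 (Finset.mem_filter.2 ⟨Finset.mem_univ _, ?_, ?_⟩)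
      · intro hki
        rw [hki, sub_self, dist_comm, dist_zero_right] at hk
        have h := hS w hwS 0 h0 hw0
        rw [dist_zero_right] at h
        linarith
      · rw [dist_comm, dist_eq_norm]
        have h := dist_triangle (y (kf w) - y i) w 0
        rw [dist_zero_right, dist_zero_right] at h
        linarith
    · intro w hw w' hw' hkeq
      by_contra hne
      have h1 := hkf w (Finset.mem_coe.1 hw)
      have h2 := hkf w' (Finset.mem_coe.1 hw')
      rw [hkeq, dist_comm] at h1
      have h := hS w (hT w (Finset.mem_coe.1 hw)).1 w' (hT w' (Finset.mem_coe.1 hw')).1 hne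
      linarith [dist_triangle w (y (kf w') - y i) w']

/-- The matching claim for a configuration MEASURE `ν = count|S` of the good set, with the two
matching clauses in the form delivered by the density transfer of the Benjamini–Schramm limit.
[folklore] -/
theorem good_of_matched_measure {N : ℕ} (y : Fin N → EuclideanSpace ℝ (Fin 3)) (i : Fin N)
    {σ δ δₓ ε : ℝ} (hε : 0 < ε) (hεσ : 2 * ε ≤ σ) (hεδ : 2 * ε < δ) (hεδₓ : 2 * ε < δₓ)
    (hsepy : ∀ j k : Fin N, j ≠ k → δₓ ≤ dist (y j) (y k))
    (ν : Measure (EuclideanSpace ℝ (Fin 3)))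
    (hgood : (∀ w : EuclideanSpace ℝ (Fin 3), ν {w} ≠ 0 → ‖w‖ ≤ 11 / 10 + σ →
        ∀ w' : EuclideanSpace ℝ (Fin 3), ν {w'} ≠ 0 → w' ≠ w → 55 / 57 + σ ≤ dist w w') ∧
      ∃ T : Finset (EuclideanSpace ℝ (Fin 3)), T.card = 12 ∧
        ∀ w ∈ T, ν {w} ≠ 0 ∧ w ≠ 0 ∧ ‖w‖ ≤ 1 - σ)
    (hcore : ∃ S : Set (EuclideanSpace ℝ (Fin 3)), (0 : EuclideanSpace ℝ (Fin 3)) ∈ S ∧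
      (∀ x ∈ S, ∀ y ∈ S, x ≠ y → δ ≤ dist x y) ∧
      ν = (Measure.count : Measure (EuclideanSpace ℝ (Fin 3))).restrict S)
    (ha : ∀ p : EuclideanSpace ℝ (Fin 3), ν {p} ≠ 0 → ‖p‖ ≤ 3 →
      ∃ q ∈ (Set.range (fun k : Fin N => y k - y i)), dist q p ≤ ε)
    (hb : ∀ q ∈ (Set.range (fun k : Fin N => y k - y i)), ‖q‖ ≤ 3 →
      ∃ p : EuclideanSpace ℝ (Fin 3), ν {p} ≠ 0 ∧ dist q p ≤ ε) :
    (∀ j : Fin N, dist (y i) (y j) ≤ 11 / 10 →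
        ∀ k : Fin N, k ≠ j → (55 : ℝ) / 57 ≤ dist (y j) (y k)) ∧
      12 ≤ (Finset.univ.filter fun j : Fin N => j ≠ i ∧ dist (y i) (y j) ≤ 1).card := by
  obtain ⟨S, h0, hS, rfl⟩ := hcore
  simp only [Literature.Probability.Process.count_restrict_singleton_ne_zero_iff] at hgood ha hb
  refine good_of_matched y i hε hεσ hεδ hεδₓ hsepy S h0 hS hgood.1 hgood.2 ?_ ?_
  · intro p hp hp3
    obtain ⟨q, ⟨k, rfl⟩, hq⟩ := ha p hp hp3
    exact ⟨k, hq⟩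
  · intro k hk
    exact hb (y k - y i) ⟨k, rfl⟩ hk

/-- **Bookkeeping.** If matched particles are good, at least `(1 - η/2)·N` of the `N ≥ 1` particles
are matched and the bad fraction is not `< η` (`η > 0`), contradiction. [folklore] -/
theorem false_of_counts {N : ℕ} {η : ℝ} (hη : 0 < η) (Good Matched : Fin N → Prop)
    (hmatched : (1 - η / 2) * (N : ℝ) ≤ (Nat.card {i : Fin N // Matched i} : ℝ))
    (hbad : ¬ dist ((Nat.card {i : Fin N // ¬ Good i} : ℝ) / (N : ℝ)) 0 < η) (hN : 1 ≤ N)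
    (hkey : ∀ i, Matched i → Good i) : False := by
  classical
  have h1 : Nat.card {i : Fin N // Matched i} ≤ Nat.card {i : Fin N // Good i} :=
    Nat.card_le_card_of_injective _ (Subtype.impEmbedding _ _ hkey).injective
  have h2 : Nat.card {i : Fin N // Good i} + Nat.card {i : Fin N // ¬ Good i} = N := by
    rw [← Nat.card_sum, Nat.card_congr (Equiv.sumCompl Good), Nat.card_eq_fintype_card,
      Fintype.card_fin]
  have hNpos : (0 : ℝ) < N := by exact_mod_cast hN
  rw [Real.dist_0_eq_abs, abs_of_nonneg (by positivity), not_lt, le_div_iff₀ hNpos] at hbad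
  have h1' : (Nat.card {i : Fin N // Matched i} : ℝ) ≤ Nat.card {i : Fin N // Good i} := by
    exact_mod_cast h1
  have h2' : (Nat.card {i : Fin N // Good i} : ℝ) + Nat.card {i : Fin N // ¬ Good i} = N := by
    exact_mod_cast h2
  nlinarith

/-- **`stub_return` (line `Sketch`, crux `TwelveWithinOne`)** — FROM MEASURE-LEVEL K2 WITH SLACK TO
THE CRUX: if every minimising point-stationary hard-core law satisfies K2 with inward slack `σ > 0`
at the root a.s., and Lennard-Jones ground states have Benjamini–Schramm limits (density-transfer
form) along every prescribed subsequence, then for every sequence of ground states the fraction of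
particles `i` failing [(∀ j within `11/10` of `x_i`: all other distances from `x_j` are `≥ 55/57`)
∧ (`≥ 12` particles `j ≠ i` within distance `1`)] tends to `0`. Proof: subsequence contradiction
via `good_of_matched` with `R = 3`, `ε = min σ (min δ δₓ) / 3`. [folklore] -/
theorem stub_return :
    ∀ σ : ℝ, 0 < σ →
    (∀ δ : ℝ, 0 < δ → ∀ P : Measure (Measure (EuclideanSpace ℝ (Fin 3))), IsProbabilityMeasure P →
      (∀ᵐ μ ∂P, (∃ S : Set (EuclideanSpace ℝ (Fin 3)), (0 : EuclideanSpace ℝ (Fin 3)) ∈ S ∧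
        (∀ x ∈ S, ∀ y ∈ S, x ≠ y → δ ≤ dist x y) ∧
        μ = (Measure.count : Measure (EuclideanSpace ℝ (Fin 3))).restrict S)) →
      (∀ g : Measure (EuclideanSpace ℝ (Fin 3)) → EuclideanSpace ℝ (Fin 3) → ℝ≥0∞,
        Measurable (Function.uncurry g) →
        ∫⁻ μ, ∫⁻ y, g μ y ∂μ ∂P = ∫⁻ μ, ∫⁻ y, g (Measure.map (fun z => z - y) μ) (-y) ∂μ ∂P) →
      (∫ μ, (∫ y, lennardJones ‖y‖ ∂μ) / 2 ∂P) ≤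
        (⨅ Q : PeriodicConfiguration 3, Q.energyPerParticle lennardJones) →
      ∀ᵐ μ ∂P,
        (∀ w : EuclideanSpace ℝ (Fin 3), μ {w} ≠ 0 → ‖w‖ ≤ 11 / 10 + σ →
            ∀ w' : EuclideanSpace ℝ (Fin 3), μ {w'} ≠ 0 → w' ≠ w → 55 / 57 + σ ≤ dist w w') ∧
          ∃ T : Finset (EuclideanSpace ℝ (Fin 3)), T.card = 12 ∧
            ∀ w ∈ T, μ {w} ≠ 0 ∧ w ≠ 0 ∧ ‖w‖ ≤ 1 - σ) →
    (∀ x : (N : ℕ) → (Fin N → EuclideanSpace ℝ (Fin 3)), (∀ N, IsGroundState lennardJones (x N)) →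
      ∀ ψ : ℕ → ℕ, StrictMono ψ →
      ∃ φ : ℕ → ℕ, StrictMono φ ∧ ∃ δ : ℝ, 0 < δ ∧
        ∃ P : Measure (Measure (EuclideanSpace ℝ (Fin 3))), IsProbabilityMeasure P ∧
        (∀ᵐ μ ∂P, (∃ S : Set (EuclideanSpace ℝ (Fin 3)), (0 : EuclideanSpace ℝ (Fin 3)) ∈ S ∧
          (∀ x ∈ S, ∀ y ∈ S, x ≠ y → δ ≤ dist x y) ∧
          μ = (Measure.count : Measure (EuclideanSpace ℝ (Fin 3))).restrict S)) ∧
        (∀ g : Measure (EuclideanSpace ℝ (Fin 3)) → EuclideanSpace ℝ (Fin 3) → ℝ≥0∞,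
          Measurable (Function.uncurry g) →
          ∫⁻ μ, ∫⁻ y, g μ y ∂μ ∂P = ∫⁻ μ, ∫⁻ y, g (Measure.map (fun z => z - y) μ) (-y) ∂μ ∂P) ∧
        Filter.Tendsto (fun j : ℕ => groundStateEnergy lennardJones 3 (ψ (φ j)) / (ψ (φ j) : ℝ))
          Filter.atTop (nhds (∫ μ, (∫ y, lennardJones ‖y‖ ∂μ) / 2 ∂P)) ∧
        ∀ T : Set (Measure (EuclideanSpace ℝ (Fin 3))), ∀ R ε : ℝ, 0 < ε → ∀ ρ : ℝ, ρ < (P T).toReal →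
          ∀ᶠ j : ℕ in Filter.atTop, ρ * (ψ (φ j) : ℝ) ≤ (Nat.card {i : Fin (ψ (φ j)) // ∃ ν ∈ T,
            ((∀ p : EuclideanSpace ℝ (Fin 3), ν {p} ≠ 0 → ‖p‖ ≤ R →
                ∃ q ∈ (Set.range (fun k : Fin (ψ (φ j)) => x (ψ (φ j)) k - x (ψ (φ j)) i)), dist q p ≤ ε) ∧
              (∀ q ∈ (Set.range (fun k : Fin (ψ (φ j)) => x (ψ (φ j)) k - x (ψ (φ j)) i)), ‖q‖ ≤ R →
                ∃ p : EuclideanSpace ℝ (Fin 3), ν {p} ≠ 0 ∧ dist q p ≤ ε))} : ℝ)) →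
    ∀ x : (N : ℕ) → (Fin N → EuclideanSpace ℝ (Fin 3)),
      (∀ N, IsGroundState lennardJones (x N)) →
      Filter.Tendsto (fun N : ℕ => (Nat.card {i : Fin N //
        ¬ ((∀ j : Fin N, dist (x N i) (x N j) ≤ 11 / 10 → ∀ k : Fin N, k ≠ j → (55 : ℝ) / 57 ≤ dist (x N j) (x N k)) ∧
          12 ≤ (Finset.univ.filter fun j : Fin N => j ≠ i ∧ dist (x N i) (x N j) ≤ 1).card)} : ℝ) / N)
        Filter.atTop (nhds 0) := by
  intro σ hσ hLaws hBS x hx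
  obtain ⟨δₓ, hδₓ, hsepx⟩ := LennardJonesMinimalDistance_holds
  rw [Metric.tendsto_nhds]
  intro η hη
  by_contra hnot
  -- a subsequence `ψ` along which the bad fraction stays `≥ η`
  obtain ⟨ψ, hψ, hψbad⟩ := Filter.extraction_of_frequently_atTop (Filter.not_eventually.1 hnot)
  -- the Benjamini–Schramm limit along `ψ ∘ φ`
  obtain ⟨φ, hφ, δ, hδ, P, hP, hcore, hstat, hE, htransfer⟩ := hBS x hx ψ hψ
  -- the limit law is minimising
  have hlim : Filter.Tendsto (fun N : ℕ => groundStateEnergy lennardJones 3 N / (N : ℝ))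
      Filter.atTop (𝓝 (⨅ Q : PeriodicConfiguration 3, Q.energyPerParticle lennardJones)) :=
    Summit.AtomisticToContinuum.Crystallization.Theses.PalmUnimodularRigidity.CrysEnergyLimit_holds
  have hEq : (∫ μ, (∫ y, lennardJones ‖y‖ ∂μ) / 2 ∂P) =
      ⨅ Q : PeriodicConfiguration 3, Q.energyPerParticle lennardJones :=
    tendsto_nhds_unique hE (hlim.comp (hψ.comp hφ).tendsto_atTop)
  have hgoodae := hLaws δ hδ P hP hcore hstat hEq.le
  -- the set of good rooted hard-core configurations has full measure
  obtain ⟨T, hTgood, hTae⟩ : ∃ T : Set (Measure (EuclideanSpace ℝ (Fin 3))),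
      (∀ ν ∈ T, ((∀ w : EuclideanSpace ℝ (Fin 3), ν {w} ≠ 0 → ‖w‖ ≤ 11 / 10 + σ →
            ∀ w' : EuclideanSpace ℝ (Fin 3), ν {w'} ≠ 0 → w' ≠ w → 55 / 57 + σ ≤ dist w w') ∧
          ∃ T : Finset (EuclideanSpace ℝ (Fin 3)), T.card = 12 ∧
            ∀ w ∈ T, ν {w} ≠ 0 ∧ w ≠ 0 ∧ ‖w‖ ≤ 1 - σ) ∧
        ∃ S : Set (EuclideanSpace ℝ (Fin 3)), (0 : EuclideanSpace ℝ (Fin 3)) ∈ S ∧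
          (∀ x ∈ S, ∀ y ∈ S, x ≠ y → δ ≤ dist x y) ∧
          ν = (Measure.count : Measure (EuclideanSpace ℝ (Fin 3))).restrict S) ∧
      ∀ᵐ μ ∂P, μ ∈ T :=
    ⟨{ν | ((∀ w : EuclideanSpace ℝ (Fin 3), ν {w} ≠ 0 → ‖w‖ ≤ 11 / 10 + σ →
            ∀ w' : EuclideanSpace ℝ (Fin 3), ν {w'} ≠ 0 → w' ≠ w → 55 / 57 + σ ≤ dist w w') ∧
          ∃ T : Finset (EuclideanSpace ℝ (Fin 3)), T.card = 12 ∧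
            ∀ w ∈ T, ν {w} ≠ 0 ∧ w ≠ 0 ∧ ‖w‖ ≤ 1 - σ) ∧
        ∃ S : Set (EuclideanSpace ℝ (Fin 3)), (0 : EuclideanSpace ℝ (Fin 3)) ∈ S ∧
          (∀ x ∈ S, ∀ y ∈ S, x ≠ y → δ ≤ dist x y) ∧
          ν = (Measure.count : Measure (EuclideanSpace ℝ (Fin 3))).restrict S},
      fun ν hν => hν, hgoodae.and hcore⟩
  have hTc : P Tᶜ = 0 := mem_ae_iff.1 hTae
  have hPT : (P T).toReal = 1 := by
    rw [measure_congr (ae_eq_univ.2 hTc), measure_univ, ENNReal.toReal_one]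
  -- the matching tolerance
  have hmin : 0 < min σ (min δ δₓ) := lt_min hσ (lt_min hδ hδₓ)
  have hminσ : min σ (min δ δₓ) ≤ σ := min_le_left _ _
  have hminδ : min σ (min δ δₓ) ≤ δ := (min_le_right _ _).trans (min_le_left _ _)
  have hminδₓ : min σ (min δ δₓ) ≤ δₓ := (min_le_right _ _).trans (min_le_right _ _)
  set ε : ℝ := min σ (min δ δₓ) / 3 with hε_def
  have hε : 0 < ε := by positivity
  have hεσ : 2 * ε ≤ σ := by linarith
  have hεδ : 2 * ε < δ := by linarith
  have hεδₓ : 2 * ε < δₓ := by linarith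
  have hρ : 1 - η / 2 < (P T).toReal := by rw [hPT]; linarith
  -- a large index along `ψ ∘ φ` where `≥ (1 - η/2)·N` particles are matched
  obtain ⟨j, hj, hj1⟩ := ((htransfer T 3 ε hε (1 - η / 2) hρ).and
    ((hψ.comp hφ).tendsto_atTop.eventually (eventually_ge_atTop 1))).exists
  refine false_of_counts hη _ _ hj (hψbad (φ j)) hj1 ?_
  rintro i ⟨ν, hνT, ha, hb⟩
  obtain ⟨hg, hc⟩ := hTgood ν hνT
  exact good_of_matched_measure (x (ψ (φ j))) i hε hεσ hεδ hεδₓ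
    (fun a b hab => hsepx _ _ (hx _) a b hab) ν hg hc ha hb

end Summit.AtomisticToContinuum.Crystallization.Theorems.SquareWellLayerCakeTwelveWithinOne

end
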